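import Summits.KontsevichZagierPeriods.KontsevichZagierPeriods.Theorems.FurushoPentagonKernelModuloPeriodConjectureLeafWeightLeSeventeen
import Summits.KontsevichZagierPeriods.KontsevichZagierPeriods.Theorems.FurushoPentagonKernelModuloPeriodConjectureLeafOfCheckBlocksCX
import Summits.KontsevichZagierPeriods.KontsevichZagierPeriods.Theorems.FurushoPentagonKernelModuloPeriodConjectureEdsChainWeightEighteen
import Summits.KontsevichZagierPeriods.KontsevichZagierPeriods.Theorems.FurushoPentagonKernelModuloPeriodConjectureEdsBlockWeightEighteenA
import Summits.KontsevichZagierPeriods.KontsevichZagierPeriods.Theorems.FurushoPentagonKernelModuloPeriodConjectureEdsBlockWeightEighteenB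
import Summits.KontsevichZagierPeriods.KontsevichZagierPeriods.Theorems.FurushoPentagonKernelModuloPeriodConjectureEdsBlockWeightEighteenC
import Summits.KontsevichZagierPeriods.KontsevichZagierPeriods.Theorems.FurushoPentagonKernelModuloPeriodConjectureEdsBlockWeightEighteenD
import Summits.KontsevichZagierPeriods.KontsevichZagierPeriods.Theorems.FurushoPentagonKernelModuloPeriodConjectureEdsBlockWeightEighteenE
import Summits.KontsevichZagierPeriods.KontsevichZagierPeriods.Theorems.FurushoPentagonKernelModuloPeriodConjectureEdsBlockWeightEighteenF
import Summits.KontsevichZagierPeriods.KontsevichZagierPeriods.Theorems.FurushoPentagonKernelModuloPeriodConjectureEdsBlockWeightEighteenG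
import Summits.KontsevichZagierPeriods.KontsevichZagierPeriods.Theorems.FurushoPentagonKernelModuloPeriodConjectureEdsBlockWeightEighteenH
import Summits.KontsevichZagierPeriods.KontsevichZagierPeriods.Theorems.FurushoPentagonKernelModuloPeriodConjectureEdsBlockWeightEighteenI
import Summits.KontsevichZagierPeriods.KontsevichZagierPeriods.Theorems.FurushoPentagonKernelModuloPeriodConjectureEdsBlockWeightEighteenJ
import Summits.KontsevichZagierPeriods.KontsevichZagierPeriods.Theorems.FurushoPentagonKernelModuloPeriodConjectureEdsBlockWeightEighteenK
import Summits.KontsevichZagierPeriods.KontsevichZagierPeriods.Theorems.FurushoPentagonKernelModuloPeriodConjectureEdsBlockWeightEighteenL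
import Summits.KontsevichZagierPeriods.KontsevichZagierPeriods.Theorems.FurushoPentagonKernelModuloPeriodConjectureEdsBlockWeightEighteenMX
import Summits.KontsevichZagierPeriods.KontsevichZagierPeriods.Theorems.FurushoPentagonKernelModuloPeriodConjectureEdsBlockWeightEighteenMB
import Summits.KontsevichZagierPeriods.KontsevichZagierPeriods.Theorems.FurushoPentagonKernelModuloPeriodConjectureEdsBlockWeightEighteenN
import Summits.KontsevichZagierPeriods.KontsevichZagierPeriods.Theorems.FurushoPentagonKernelModuloPeriodConjectureEdsBlockWeightEighteenO
import Summits.KontsevichZagierPeriods.KontsevichZagierPeriods.Theorems.FurushoPentagonKernelModuloPeriodConjectureEdsBlockWeightEighteenP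
import Summits.KontsevichZagierPeriods.KontsevichZagierPeriods.Theorems.FurushoPentagonKernelModuloPeriodConjectureEdsBlockWeightEighteenQ
import Summits.KontsevichZagierPeriods.KontsevichZagierPeriods.Theorems.FurushoPentagonKernelModuloPeriodConjectureEdsBlockWeightEighteenR
import Summits.KontsevichZagierPeriods.KontsevichZagierPeriods.Theorems.FurushoPentagonKernelModuloPeriodConjectureEdsBlockWeightEighteenMC
import Summits.KontsevichZagierPeriods.KontsevichZagierPeriods.Theorems.FurushoPentagonKernelModuloPeriodConjectureEdsBlockWeightEighteenSA
import Summits.KontsevichZagierPeriods.KontsevichZagierPeriods.Theorems.FurushoPentagonKernelModuloPeriodConjectureEdsBlockWeightEighteenT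
import Summits.KontsevichZagierPeriods.KontsevichZagierPeriods.Theorems.FurushoPentagonKernelModuloPeriodConjectureEdsBlockWeightEighteenU
import Summits.KontsevichZagierPeriods.KontsevichZagierPeriods.Theorems.FurushoPentagonKernelModuloPeriodConjectureEdsBlockWeightEighteenV
import Summits.KontsevichZagierPeriods.KontsevichZagierPeriods.Theorems.FurushoPentagonKernelModuloPeriodConjectureEdsBlockWeightEighteenW
import Summits.KontsevichZagierPeriods.KontsevichZagierPeriods.Theorems.FurushoPentagonKernelModuloPeriodConjectureEdsBlockWeightEighteenX
import Summits.KontsevichZagierPeriods.KontsevichZagierPeriods.Theorems.FurushoPentagonKernelModuloPeriodConjectureEdsBlockWeightEighteenY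
import Summits.KontsevichZagierPeriods.KontsevichZagierPeriods.Theorems.FurushoPentagonKernelModuloPeriodConjectureEdsBlockWeightEighteenSB
import Summits.KontsevichZagierPeriods.KontsevichZagierPeriods.Theorems.FurushoPentagonKernelModuloPeriodConjectureEdsBlockWeightEighteenSC
import Summits.KontsevichZagierPeriods.KontsevichZagierPeriods.Theorems.FurushoPentagonKernelModuloPeriodConjectureEdsBlockWeightEighteenAA
import Summits.KontsevichZagierPeriods.KontsevichZagierPeriods.Theorems.FurushoPentagonKernelModuloPeriodConjectureEdsBlockWeightEighteenAB
import Summits.KontsevichZagierPeriods.KontsevichZagierPeriods.Theorems.FurushoPentagonKernelModuloPeriodConjectureEdsBlockWeightEighteenAC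
import Summits.KontsevichZagierPeriods.KontsevichZagierPeriods.Theorems.FurushoPentagonKernelModuloPeriodConjectureEdsBlockWeightEighteenAD
import Summits.KontsevichZagierPeriods.KontsevichZagierPeriods.Theorems.FurushoPentagonKernelModuloPeriodConjectureEdsBlockWeightEighteenAE
import Summits.KontsevichZagierPeriods.KontsevichZagierPeriods.Theorems.FurushoPentagonKernelModuloPeriodConjectureEdsBlockWeightEighteenAF
import Summits.KontsevichZagierPeriods.KontsevichZagierPeriods.Theorems.FurushoPentagonKernelModuloPeriodConjectureEdsBlockWeightEighteenAG
import Summits.KontsevichZagierPeriods.KontsevichZagierPeriods.Theorems.FurushoPentagonKernelModuloPeriodConjectureEdsBlockWeightEighteenAH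
import Summits.KontsevichZagierPeriods.KontsevichZagierPeriods.Theorems.FurushoPentagonKernelModuloPeriodConjectureEdsBlockWeightEighteenAI
import Summits.KontsevichZagierPeriods.KontsevichZagierPeriods.Theorems.FurushoPentagonKernelModuloPeriodConjectureEdsBlockWeightEighteenZA
import Summits.KontsevichZagierPeriods.KontsevichZagierPeriods.Theorems.FurushoPentagonKernelModuloPeriodConjectureEdsBlockWeightEighteenZB
import Summits.KontsevichZagierPeriods.KontsevichZagierPeriods.Theorems.FurushoPentagonKernelModuloPeriodConjectureEdsBlockWeightEighteenZC
import Summits.KontsevichZagierPeriods.KontsevichZagierPeriods.Theorems.FurushoPentagonKernelModuloPeriodConjectureEdsBlockWeightEighteenJA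
import Summits.KontsevichZagierPeriods.KontsevichZagierPeriods.Theorems.FurushoPentagonKernelModuloPeriodConjectureEdsBlockWeightEighteenJB
import Summits.KontsevichZagierPeriods.KontsevichZagierPeriods.Theorems.FurushoPentagonKernelModuloPeriodConjectureEdsBlockWeightEighteenJC
import Summits.KontsevichZagierPeriods.KontsevichZagierPeriods.Theorems.FurushoPentagonKernelModuloPeriodConjectureEdsBlockWeightEighteenTA
import Summits.KontsevichZagierPeriods.KontsevichZagierPeriods.Theorems.FurushoPentagonKernelModuloPeriodConjectureEdsBlockWeightEighteenTB
import Summits.KontsevichZagierPeriods.KontsevichZagierPeriods.Theorems.FurushoPentagonKernelModuloPeriodConjectureEdsBlockWeightEighteenTC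
import Summits.KontsevichZagierPeriods.KontsevichZagierPeriods.Theorems.FurushoPentagonKernelModuloPeriodConjectureEdsBlockWeightEighteenTD
import Summits.KontsevichZagierPeriods.KontsevichZagierPeriods.Theorems.FurushoPentagonKernelModuloPeriodConjectureEdsBlockWeightEighteenTE
import Summits.KontsevichZagierPeriods.KontsevichZagierPeriods.Theorems.FurushoPentagonKernelModuloPeriodConjectureEdsBlockWeightEighteenTF
import HarnessLib

/-!
# `KernelModuloPeriodConjecture`, line `Sketch`: Hoffman spanning for abstract associators, weight ≤ 18

Crux `FurushoPentagon.KernelModuloPeriodConjecture` (stmt-KontsevichZagierPeriods-15058), line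
`Sketch`, lead c7. ONE citable theorem extending the weight `≤ 17` assembly
(`stub_associatorHoffmanSpanning_of_weight_le_17`) by weight `18`: for EVERY admissible index
`s` of weight `≤ 18` there is one finitely supported `b` on Hoffman indices of the same weight
with `c_{bw s}(φ) = Σ_t b_t c_{bw t}(φ)` at every group-like solution `φ` of Drinfeld's pentagon
over every commutative `ℚ`-algebra — the coordinate form of `GRT₁ ≅ U^{dR}_{MT(ℤ)}`
(equivalently `𝔤𝔯𝔱₁ = 𝔤^𝔪`) in weights `≤ 18` for abstract associators, as a kernel-checked
theorem. Weight `18` (`2^16 − d_18` non-Hoffman admissible words) is Ihara–Kaneko–Zagier's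
linearised extended double shuffle system reduced mod 2 in `50` CELL blocks (engine
`Literature/NumberTheory/Transcendental/LinEDSCells.lean`: a block is a union of cells = columns
of one depth with prescribed last parts, its bitset generated by a DP, so that no block exceeds
one gate elaboration slot although the exact-depth blocks of weight 18 have up to `C(15,7) = 6435`
columns): blocks (columns, slot width) A (1500, 12691, 184 precomputed fillers), B (1017, 10901, 6 groups), C (1365, 19093, 158 precomputed fillers), D (1386, 16385, 2 groups), E (1400, 8189, 9 groups), F (216, 2049), G (1386, 16385, 355 precomputed fillers), H (1491, 8189), I (1451, 12287, 16 groups), J (1477, 12293), K (1454, 8189, 6 groups), L (714, 2049), MX (1210, 8193, 230 precomputed fillers), MB (792, 3071, 85 groups), N (2079, 8193), O (2085, 8179), P (1821, 8165), Q (2045, 8189, 1 groups), R (1380, 6137), MC (825, 4097, 519 precomputed fillers), SA (1254, 6149, 210 precomputed fillers), T (1716, 6487), U (2100, 8193), V (2046, 8155, 1 groups), W (1925, 8185), X (2094, 8189, 1 groups), Y (909, 6137), SB (792, 3071, 451 precomputed fillers), SC (924, 3071, 204 groups), AA (1716, 6143), AB (1716, 6143), AC (1287, 6143), AD (1716, 6143),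 AE (2079, 12293), AF (1210, 8193), AG (1716, 6143, 212 groups), AH (2079, 12293), AI (2002, 12287, 2 groups), ZA (1210, 8193), ZB (1001, 10901), ZC (1287, 6143), JA (715, 6143), JB (1001, 10901), JC (1166, 10901), TA (199, 2117), TB (1001, 10901), TC (819, 10923), TD (560, 4369), TE (120, 2067), TF (17, 2049); grouped rows where the natural rows of a block are
rank-deficient mod 2, the two most deficient blocks with their filler rows precomputed and certified
by provenance files (`checkBlockCX`, `checkExtra`); chain condition `stub_chainOK_18`; assembled by
the cell block master `stub_leaf_of_checkBlocksCX`. For comparison, the printed verifications of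
IKZ's Conjecture 1 are numerical (IKZ) or ranks of the EDS matrix of REAL multiple zeta values
modulo a large prime (Kaneko–Noro–Tsurumaki 2008, weight ≤ 20); here the statement is for every
group-like solution of the pentagon over every commutative `ℚ`-algebra and is checked by Lean's
kernel.

References: K. Ihara, M. Kaneko, D. Zagier, Compos. Math. 142 (2006) §2, Conjecture 1
[IharaKanekoZagier2006]; M. Kaneko, M. Noro, K. Tsurumaki, IMA Vol. Math. Appl. 148 (2008)
47–58; H. Furusho, Ann. of Math. 174 (2011) Thm 1.2 [Furusho2011]; F. Brown, Ann. of Math. 175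
(2012) Thm 1.1 [Brown2012]; V. Drinfeld, Leningrad Math. J. 2 (1991).
-/

namespace Summit.KontsevichZagierPeriods.FurushoPentagon.KernelModuloPeriodConjecture

open Literature.NumberTheory.Transcendental

/-- **The weight-18 slice of the algebraic leaf**: Hoffman spanning for every admissible index of
weight `18` at every group-like pentagon solution, from the `50` cell block certificates and the
chain condition `stub_chainOK_18` by the cell block master (plain blocks `checkBlockC`, blocks with
precomputed fillers `checkBlockCX` + provenance). [cite: IharaKanekoZagier2006, Conjecture 1] -/
theorem leafWeightEighteen (s : List ℕ) (hs : MZV.IsAdmissible s) (hw : MZV.weight s = 18) :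
    ∃ b : List ℕ →₀ ℚ, (∀ t ∈ b.support, MZV.IsHoffman t ∧ MZV.weight t = MZV.weight s) ∧ ∀ (R : Type) [CommRing R] [Algebra ℚ R] [IsReduced R] (φ : NCSeries Bool R), NCSeries.IsGroupLike φ → NCSeries.DrinfeldPentagon φ → φ (MZV.binaryWord s) = b.sum (fun t q => q • φ (MZV.binaryWord t)) := by
  refine stub_leaf_of_checkBlocksCX 18 _ (by norm_num) stub_chainOK_18 (fun p hp => ?_) s hs hw
  simp only [List.mem_cons, List.not_mem_nil, or_false] at hp
  rcases hp with rfl | rfl | rfl | rfl | rfl | rfl | rfl | rfl | rfl | rfl | rfl | rfl | rfl | rfl | rfl | rfl | rfl | rfl | rfl | rfl | rfl | rfl | rfl | rfl | rfl | rfl | rfl | rfl | rfl | rfl | rfl | rfl | rfl | rfl | rfl | rfl | rfl | rfl | rfl | rfl | rfl | rfl | rfl | rfl | rfl | rfl | rfl | rfl | rfl | rfl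
  · exact Or.inr stub_edsBlockCX_18_A
  · exact Or.inl stub_edsBlockC_18_B
  · exact Or.inr stub_edsBlockCX_18_C
  · exact Or.inl stub_edsBlockC_18_D
  · exact Or.inl stub_edsBlockC_18_E
  · exact Or.inl stub_edsBlockC_18_F
  · exact Or.inr stub_edsBlockCX_18_G
  · exact Or.inl stub_edsBlockC_18_H
  · exact Or.inl stub_edsBlockC_18_I
  · exact Or.inl stub_edsBlockC_18_J
  · exact Or.inl stub_edsBlockC_18_K
  · exact Or.inl stub_edsBlockC_18_L
  · exact Or.inr stub_edsBlockCX_18_MX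
  · exact Or.inl stub_edsBlockC_18_MB
  · exact Or.inl stub_edsBlockC_18_N
  · exact Or.inl stub_edsBlockC_18_O
  · exact Or.inl stub_edsBlockC_18_P
  · exact Or.inl stub_edsBlockC_18_Q
  · exact Or.inl stub_edsBlockC_18_R
  · exact Or.inr stub_edsBlockCX_18_MC
  · exact Or.inr stub_edsBlockCX_18_SA
  · exact Or.inl stub_edsBlockC_18_T
  · exact Or.inl stub_edsBlockC_18_U
  · exact Or.inl stub_edsBlockC_18_V
  · exact Or.inl stub_edsBlockC_18_W
  · exact Or.inl stub_edsBlockC_18_X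
  · exact Or.inl stub_edsBlockC_18_Y
  · exact Or.inr stub_edsBlockCX_18_SB
  · exact Or.inl stub_edsBlockC_18_SC
  · exact Or.inl stub_edsBlockC_18_AA
  · exact Or.inl stub_edsBlockC_18_AB
  · exact Or.inl stub_edsBlockC_18_AC
  · exact Or.inl stub_edsBlockC_18_AD
  · exact Or.inl stub_edsBlockC_18_AE
  · exact Or.inl stub_edsBlockC_18_AF
  · exact Or.inl stub_edsBlockC_18_AG
  · exact Or.inl stub_edsBlockC_18_AH
  · exact Or.inl stub_edsBlockC_18_AI
  · exact Or.inl stub_edsBlockC_18_ZA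
  · exact Or.inl stub_edsBlockC_18_ZB
  · exact Or.inl stub_edsBlockC_18_ZC
  · exact Or.inl stub_edsBlockC_18_JA
  · exact Or.inl stub_edsBlockC_18_JB
  · exact Or.inl stub_edsBlockC_18_JC
  · exact Or.inl stub_edsBlockC_18_TA
  · exact Or.inl stub_edsBlockC_18_TB
  · exact Or.inl stub_edsBlockC_18_TC
  · exact Or.inl stub_edsBlockC_18_TD
  · exact Or.inl stub_edsBlockC_18_TE
  · exact Or.inl stub_edsBlockC_18_TF

/-- **Registered stub `stub_associatorHoffmanSpanning_of_weight_le_18`** (lead c7; crux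
stmt-KontsevichZagierPeriods-15058, line `Sketch`): the algebraic leaf `AssociatorHoffmanSpanning`
for every admissible index of weight at most `18` — weight `≤ 17` is the tree theorem
`stub_associatorHoffmanSpanning_of_weight_le_17`, weight `18` is `leafWeightEighteen`.
[cite: IharaKanekoZagier2006, Conjecture 1] -/
theorem stub_associatorHoffmanSpanning_of_weight_le_18 :
    ∀ s : List ℕ, MZV.IsAdmissible s → MZV.weight s ≤ 18 →
      ∃ b : List ℕ →₀ ℚ, (∀ t ∈ b.support, MZV.IsHoffman t ∧ MZV.weight t = MZV.weight s) ∧ ∀ (R : Type) [CommRing R] [Algebra ℚ R] [IsReduced R] (φ : NCSeries Bool R), NCSeries.IsGroupLike φ → NCSeries.DrinfeldPentagon φ → φ (MZV.binaryWord s) = b.sum (fun t q => q • φ (MZV.binaryWord t)) := by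
  intro s hs h18
  by_cases h17 : MZV.weight s ≤ 17
  · exact stub_associatorHoffmanSpanning_of_weight_le_17 s hs h17
  · exact leafWeightEighteen s hs (by omega)

end Summit.KontsevichZagierPeriods.FurushoPentagon.KernelModuloPeriodConjecture
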